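import Summits.CriticalPhenomena.SAWScalingLimit.Theorems.SAWLeftRightFKGFKGToTraversalBoundWitnessChildRank
import Summits.CriticalPhenomena.SAWScalingLimit.Theorems.SAWLeftRightFKGFKGToTraversalBoundOutlineSide
import HarnessLib

/-!
# Witness glue T4: child side and rank of a far-tip configuration (line `slit-necklace`)

Crux `SAWLeftRightFKG.FKGToTraversalBound` (stmt-CriticalPhenomena-1878), line `slit-necklace`, lead
prover-line-stmt-CriticalPhenomena-1878-c5-0; registered stub `witness_childSide` (witness glue unit T4), on top of
the vocabulary `…WitnessCfg` (`FarTipCfg`, `Fset`, `K`, `Ext`, `V`, `pend`, `NonDeg`, `U`, `compU`, `rootAt`, `desc`,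
`rk`), the piece facts and the rank lemma `child_rk_lt_of_mem_desc` (`…WitnessChildRank`), and the planar dichotomy
`btour_rootSide_dichotomy` (`…OutlineSide`).

Setting: `cfg : FarTipCfg D` (a presented configuration with a far-tip piece `P = (i, j; τ, τ')`), `F` the free
component of the first tip `t₀ = γ τ` (joined to `t₀` in the carrier graph off the attached set `K = Sp ∪ Ext`),
`e₀` and `btour F e₀ n₁` the two tip edges of the wall-follower tour of `F` (period `N`, contacts `γ (τ - 1)` and
`γ (τ' + 1)`).  Claim: on one of the two arcs `(0, n₁)`, `(n₁, N)` every contact lying strictly inside a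
non-degenerate far piece `i'' ≠ i` has `rk i'' < rk i`.

Proof.  `F ⊆ U = Λ ∖ Sp` lies in the `U`-component of `γ (i + 1)` (through `t₀` and the first stub), so a free
contact inside the piece `i''` puts `γ (i'' + 1)` in that component.  Let `z₀ = rootAt (γ (i + 1))`.  If `z₀` is an
interior vertex of `P`, every `U`-walk to `z₀` meets `V_P` and either arc will do.  Otherwise the middle
`β = γ[τ .. τ']` (inside `F`, inside `V_P`) and the outer barrier `ω` from `γ (τ - 1)` to `γ (τ' + 1)` (first stub,
spine and trace of `C` — the spine is attached —, last stub; outside `F`, inside `V_P ∪ Sp ∪ trace`) both avoid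
`z₀ ∈ U ∖ V_P`, and `btour_rootSide_dichotomy` forbids contacts joined to `z₀` off `β ∪ ω` on both arcs; on the arc
without them, every `U`-walk from a contact to `z₀` meets `V_P` (a `U`-walk avoids the spine and the trace).  In
both cases a contact `c ∈ V_{i''}` gives `i'' ∈ desc i` (prefix any `U`-walk from `V_{i''}` by a walk inside
`V_{i''}`, which is disjoint from `V_P`), and `child_rk_lt_of_mem_desc` concludes.

All statements folklore (boundary tracing of a polyomino, discrete planar separation already formalised in
`…OutlineSide`); no literature fact is introduced; nothing restates the crux.
-/

noncomputable section

open Set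
open Literature.Probability.LatticeModels
open Literature.Probability.RandomPlanarGeometry
open Literature.Probability.RandomPlanarGeometry.SAW
open Summit.CriticalPhenomena.SAWScalingLimit.Theorems.FKGToTraversalBound.Negative (dom)

namespace Summit.CriticalPhenomena.SAWScalingLimit.Theorems.FKGToTraversalBound.SlitNecklace

namespace FarTipCfg

variable {D : DobrushinDomain} (cfg : FarTipCfg D)

/-! ### The far-tip piece itself -/

/-- The far-tip piece is a far piece: `i` is a far start. [folklore] -/
theorem child_i_mem_farStarts : cfg.i ∈ cfg.farStarts :=
  ⟨cfg.j, cfg.hft.isFarPiece _⟩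

/-- The end of the far-tip piece is `j`. [folklore] -/
theorem child_pend_i : cfg.pend cfg.i = cfg.j :=
  cfg.child_pend_eq cfg.hft.1

/-- The far-tip piece is non-degenerate (`i < τ < τ' < j`). [folklore] -/
theorem child_nonDeg_i : cfg.NonDeg cfg.i := by
  have := cfg.idx_facts
  unfold PresCfg.NonDeg
  rw [cfg.child_pend_i]
  omega

/-- Vertices of index strictly between `i` and `j` are interior vertices of the far-tip piece. [folklore] -/
theorem child_mem_VP {m : ℕ} (h1 : cfg.i < m) (h2 : m < cfg.j) : cfg.γ.getVert m ∈ cfg.V cfg.i (cfg.pend cfg.i) := by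
  rw [cfg.child_pend_i]
  exact ⟨m, h1, h2, rfl⟩

/-- The interior of the far-tip piece is free. [folklore] -/
theorem child_VP_subset_U : cfg.V cfg.i (cfg.pend cfg.i) ⊆ cfg.U :=
  cfg.child_V_subset_U _ cfg.child_i_mem_farStarts cfg.child_nonDeg_i

/-- The first interior vertex of the far-tip piece is free. [folklore] -/
theorem child_succ_i_mem_U : cfg.γ.getVert (cfg.i + 1) ∈ cfg.U :=
  cfg.child_VP_subset_U (cfg.child_mem_VP (by omega) (by have := cfg.idx_facts; omega))

/-- The start of the far-tip piece is a spine site. [folklore] -/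
theorem child_getVert_i_mem_Sp : cfg.γ.getVert cfg.i ∈ cfg.Sp :=
  Finset.mem_coe.1 cfg.hft.1.1.2

/-- The end of the far-tip piece is a spine site. [folklore] -/
theorem child_getVert_j_mem_Sp : cfg.γ.getVert cfg.j ∈ cfg.Sp :=
  Finset.mem_coe.1 cfg.hft.1.2.1.2

/-! ### The middle and the outer barrier -/

/-- **The middle** `γ[τ .. τ']` as a lattice walk through vertices of index in `[τ, τ']` only. [folklore] -/
theorem child_exists_middle : ∃ β : (zdGraph 2).Walk cfg.t₀ cfg.t₁,
    ∀ z ∈ β.support, ∃ m, cfg.τ ≤ m ∧ m ≤ cfg.τ' ∧ cfg.γ.getVert m = z := by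
  have := cfg.idx_facts
  exact child_subwalk' cfg.child_Dg_le cfg.γ (a := cfg.τ) (b := cfg.τ') (by omega) (by omega)

/-- **The outer barrier**: a lattice walk from `γ (τ - 1)` to `γ (τ' + 1)` along the first stub down to `γ i`,
through the spine and the trace of `C` (the spine is attached to the trace) to `γ j`, and along the last stub; all
its vertices are stub vertices, spine sites or trace vertices. [folklore] -/
theorem child_exists_barrier : ∃ ω : (zdGraph 2).Walk (cfg.γ.getVert (cfg.τ - 1)) (cfg.γ.getVert (cfg.τ' + 1)),
    ∀ z ∈ ω.support, (∃ m, cfg.i ≤ m ∧ m < cfg.τ ∧ cfg.γ.getVert m = z) ∨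
      (∃ m, cfg.τ' < m ∧ m ≤ cfg.j ∧ cfg.γ.getVert m = z) ∨ z ∈ cfg.Sp ∨ z ∈ cfg.C.support := by
  classical
  have hidx := cfg.idx_facts
  -- the two stubs
  obtain ⟨ω₁, hω₁⟩ := child_subwalk' cfg.child_Dg_le cfg.γ (a := cfg.i) (b := cfg.τ - 1) (by omega) (by omega)
  obtain ⟨ω₃, hω₃⟩ := child_subwalk' cfg.child_Dg_le cfg.γ (a := cfg.τ' + 1) (b := cfg.j) (by omega) (by omega)
  -- through the spine and the trace
  obtain ⟨qi, wi, hqi, hwi⟩ := cfg.hatt _ cfg.child_getVert_i_mem_Sp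
  obtain ⟨qj, wj, hqj, hwj⟩ := cfg.hatt _ cfg.child_getVert_j_mem_Sp
  set ω₂ : (zdGraph 2).Walk (cfg.γ.getVert cfg.i) (cfg.γ.getVert cfg.j) :=
    wi.append (((cfg.C.dropUntil qi hqi).append (cfg.C.takeUntil qj hqj)).append wj.reverse) with hω₂
  have hω₂s : ∀ z ∈ ω₂.support, z ∈ cfg.Sp ∨ z ∈ cfg.C.support := by
    intro z hz
    simp only [hω₂, SimpleGraph.Walk.mem_support_append_iff, SimpleGraph.Walk.support_reverse,
      List.mem_reverse] at hz
    rcases hz with hz | (hz | hz) | hz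
    · exact hwi z hz
    · exact Or.inr (cfg.C.support_dropUntil_subset_support hqi hz)
    · exact Or.inr (cfg.C.support_takeUntil_subset_support hqj hz)
    · exact hwj z hz
  refine ⟨ω₁.reverse.append (ω₂.append ω₃.reverse), fun z hz => ?_⟩
  rw [SimpleGraph.Walk.mem_support_append_iff, SimpleGraph.Walk.mem_support_append_iff,
    SimpleGraph.Walk.support_reverse, List.mem_reverse, SimpleGraph.Walk.support_reverse,
    List.mem_reverse] at hz
  rcases hz with hz | hz | hz
  · obtain ⟨m, h1, h2, h3⟩ := hω₁ z hz
    exact Or.inl ⟨m, h1, by omega, h3⟩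
  · exact Or.inr (Or.inr (hω₂s z hz))
  · obtain ⟨m, h1, h2, h3⟩ := hω₃ z hz
    exact Or.inr (Or.inl ⟨m, by omega, h2, h3⟩)

/-- **A free site off the interior of the far-tip piece is off the barrier class.** [folklore] -/
theorem child_not_outer {z : Site 2} (hzU : z ∈ cfg.U) (hzV : z ∉ cfg.V cfg.i (cfg.pend cfg.i)) :
    ¬ ((∃ m, cfg.i ≤ m ∧ m < cfg.τ ∧ cfg.γ.getVert m = z) ∨
      (∃ m, cfg.τ' < m ∧ m ≤ cfg.j ∧ cfg.γ.getVert m = z) ∨ z ∈ cfg.Sp ∨ z ∈ cfg.C.support) := by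
  have hidx := cfg.idx_facts
  rintro (⟨m, h1, h2, rfl⟩ | ⟨m, h1, h2, rfl⟩ | h | h)
  · rcases Nat.eq_or_lt_of_le h1 with rfl | h1
    · exact hzU.2 cfg.child_getVert_i_mem_Sp
    · exact hzV (cfg.child_mem_VP h1 (by omega))
  · rcases Nat.eq_or_lt_of_le h2 with rfl | h2
    · exact hzU.2 cfg.child_getVert_j_mem_Sp
    · exact hzV (cfg.child_mem_VP (by omega) h2)
  · exact hzU.2 h
  · exact cfg.child_notMem_Λ_of_mem_support h hzU.1

/-- **The barrier class avoids the free set** (stubs are exterior vertices, the spine is attached, the trace is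
off `Λ`). [folklore] -/
theorem child_outer_notMem (F : Finset (Site 2)) (hFK : ∀ x ∈ F, x ∉ cfg.K) (hFΛ : ∀ x ∈ F, x ∈ cfg.Λ)
    {z : Site 2} (hz : (∃ m, cfg.i ≤ m ∧ m < cfg.τ ∧ cfg.γ.getVert m = z) ∨
      (∃ m, cfg.τ' < m ∧ m ≤ cfg.j ∧ cfg.γ.getVert m = z) ∨ z ∈ cfg.Sp ∨ z ∈ cfg.C.support) : z ∉ F := by
  have hidx := cfg.idx_facts
  intro hzF
  rcases hz with ⟨m, -, h2, rfl⟩ | ⟨m, h1, h2, rfl⟩ | h | h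
  · exact hFK _ hzF (Finset.mem_union_right _ (cfg.mem_Ext_iff.2 ⟨m, by omega, Or.inl h2, rfl⟩))
  · exact hFK _ hzF (Finset.mem_union_right _ (cfg.mem_Ext_iff.2 ⟨m, by omega, Or.inr h1, rfl⟩))
  · exact hFK _ hzF (Finset.mem_union_left _ h)
  · exact cfg.child_notMem_Λ_of_mem_support h (hFΛ z hzF)

/-! ### From "not root-side" to descent -/

/-- **A contact in the interior of another non-degenerate far piece, all of whose `U`-walks to the root meet the
interior of the far-tip piece, makes that piece a descendant of the far-tip piece.** [folklore] -/
theorem child_mem_desc_of_sep {c : Site 2} {i'' : ℕ} (hfs : i'' ∈ cfg.farStarts) (hnd : cfg.NonDeg i'')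
    (hne : i'' ≠ cfg.i) (hc : c ∈ cfg.V i'' (cfg.pend i'')) (hcc : c ∈ cfg.compU (cfg.γ.getVert (cfg.i + 1)))
    (hsep : ∀ π : (zdGraph 2).Walk c (cfg.rootAt (cfg.γ.getVert (cfg.i + 1))), (∀ z ∈ π.support, z ∈ cfg.U) →
      ∃ z ∈ π.support, z ∈ cfg.V cfg.i (cfg.pend cfg.i)) :
    i'' ∈ cfg.desc cfg.i := by
  have hI := cfg.child_idx_of_mem_farStarts hfs
  have hV''U := cfg.child_V_subset_U i'' hfs hnd
  rw [cfg.child_mem_desc_iff]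
  refine ⟨by omega, hne, hfs, hnd, ?_, fun x hx w hwU => ?_⟩
  · obtain ⟨w, hw⟩ := cfg.child_V_walk hI.2 hc
    refine cfg.child_mem_compU_of_walk w.reverse (fun z hz => hV''U (hw z ?_)) hcc
    rwa [SimpleGraph.Walk.support_reverse, List.mem_reverse] at hz
  · by_contra hno
    push Not at hno
    obtain ⟨w₁, hw₁⟩ := cfg.child_V_walk₂ hI.2 hc hx
    obtain ⟨z, hz, hzV⟩ := hsep (w₁.append w) fun z hz => by
      rw [SimpleGraph.Walk.mem_support_append_iff] at hz
      exact hz.elim (fun h => hV''U (hw₁ z h)) (hwU z)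
    rw [SimpleGraph.Walk.mem_support_append_iff] at hz
    rcases hz with hz | hz
    · exact Set.disjoint_left.1 (cfg.child_V_disjoint (cfg.child_isPiece_of_mem_farStarts hfs)
        (cfg.child_isPiece_of_mem_farStarts cfg.child_i_mem_farStarts) hne) (hw₁ z hz) hzV
    · exact hno z hz hzV

end FarTipCfg

/-! ### The registered stub -/

/-- **Registered stub (witness glue T4): child side and rank.**  One of the two tour arcs `(0, n₁)`, `(n₁, N)`
between the tip edges touches, strictly inside, only non-degenerate far pieces of rank smaller than that of the
far-tip piece.  Proof: the free set `F` lies in the `U`-component of `γ (i + 1)`; if the root `z₀` of that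
component is an interior vertex of the far-tip piece `P`, every `U`-walk to it meets `V_P` and either arc will do;
otherwise apply `btour_rootSide_dichotomy` to the middle `β = γ[τ .. τ']` (inside `F`) and the outer barrier `ω`
(stubs, spine, trace; outside `F`), both avoiding `z₀`: on one arc no contact is joined to `z₀` off `β ∪ ω`, so
every `U`-walk from such a contact to `z₀` meets `V_P` (a `U`-walk avoids the spine and the trace, and the
stubs and the middle lie in `V_P`); a contact inside another non-degenerate far piece `i''` then puts `i''` in
`desc i` (`child_mem_desc_of_sep`), and ranks decrease along descent (`child_rk_lt_of_mem_desc`). [folklore] -/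
theorem witness_childSide : ∀ {D : DobrushinDomain} (cfg : FarTipCfg D) (F B : Finset (Site 2)) (e₀ : Site 2 × ODir) (n₁ N : ℕ), (∀ x, x ∈ F ↔ x ∈ cfg.Fset) → (∀ x, x ∈ B ↔ x ∈ cfg.Bset) → (∀ x ∈ B, x ∈ cfg.Λ) → (∀ m, cfg.τ ≤ m → m ≤ cfg.τ' → cfg.γ.getVert m ∈ F) → (∀ x ∈ F, x ∉ cfg.K) → (∀ x ∈ F, ∀ y ∈ F, ∃ p : (zdGraph 2).Walk x y, ∀ z ∈ p.support, z ∈ F) → (∀ x ∈ F, ∀ y : Site 2, y ∉ F → (zdGraph 2).Adj x y → y ∈ cfg.K ∨ y ∈ cfg.C.support) → (∀ x ∈ F, ∀ y ∈ F, (zdGraph 2).Adj x y → cfg.G.Adj x y) → (∀ x ∈ B, ∀ y ∈ B, (zdGraph 2).Adj x y → cfg.G.Adj x y) → (∀ k ∈ cfg.K, ∃ (q : Site 2) (w : (zdGraph 2).Walk k q), q ∈ cfg.C.support ∧ ∀ z ∈ w.support, z ∈ cfg.K ∨ z ∈ cfg.C.support) → IsBEdge (↑F : Set (Site 2)) e₀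 → bsite e₀ = cfg.t₀ → bcontact e₀ = cfg.γ.getVert (cfg.τ - 1) → 0 < n₁ → n₁ < N → btour (↑F : Set (Site 2)) e₀ N = e₀ → (∀ j j', j < N → j' < N → btour (↑F : Set (Site 2)) e₀ j = btour (↑F : Set (Site 2)) e₀ j' → j = j') → bsite (btour (↑F : Set (Site 2)) e₀ n₁) = cfg.t₁ → bcontact (btour (↑F : Set (Site 2)) e₀ n₁) = cfg.γ.getVert (cfg.τ' + 1) → ∃ m n : ℕ, ((m = 0 ∧ n = n₁) ∨ (m = n₁ ∧ n = N)) ∧ ∀ (q i'' : ℕ), m < q → q < n → i'' ∈ cfg.farStarts → cfg.NonDeg i'' → i'' ≠ cfg.i → bcontact (btour (↑F : Set (Site 2)) e₀ q) ∈ cfg.V i'' (cfg.pend i'') → cfg.rk i'' < cfg.rk cfg.i := by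
  intro D cfg F B e₀ n₁ N hF hB hBΛ hmid hFK hFconn _ _ _ _ he₀ hbs₀ hbc₀ hn₁ hn₁N hN hinj hbs₁ hbc₁
  classical
  have hidx := cfg.idx_facts
  -- the component of `γ (i + 1)` and its root
  have hiU : cfg.γ.getVert (cfg.i + 1) ∈ cfg.U := cfg.child_succ_i_mem_U
  have hz₀ : cfg.rootAt (cfg.γ.getVert (cfg.i + 1)) ∈ cfg.compU (cfg.γ.getVert (cfg.i + 1)) :=
    cfg.child_rootAt_mem hiU
  have hz₀U : cfg.rootAt (cfg.γ.getVert (cfg.i + 1)) ∈ cfg.U := cfg.child_mem_U_of_mem_compU hz₀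
  -- the free set lies in `U` and in that component
  have hFΛ : ∀ x ∈ F, x ∈ cfg.Λ := fun x hx => hBΛ x ((hB x).2 (cfg.Fset_subset_Bset ((hF x).1 hx)))
  have hFU : ∀ x ∈ F, x ∈ cfg.U := fun x hx =>
    ⟨hFΛ x hx, fun hSp => hFK x hx (Finset.mem_union_left _ hSp)⟩
  have ht₀F : cfg.t₀ ∈ F := hmid cfg.τ le_rfl hidx.2.1.le
  have ht₀c : cfg.t₀ ∈ cfg.compU (cfg.γ.getVert (cfg.i + 1)) := by
    obtain ⟨w, hw⟩ := cfg.child_V_walk (i' := cfg.i) (j' := cfg.pend cfg.i)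
      (cfg.child_idx_of_mem_farStarts cfg.child_i_mem_farStarts).2 (cfg.child_mem_VP hidx.1 (by omega))
    exact cfg.child_mem_compU_of_walk w (fun z hz => cfg.child_VP_subset_U (hw z hz)) (cfg.child_mem_compU_self hiU)
  have hFc : ∀ x ∈ F, x ∈ cfg.compU (cfg.γ.getVert (cfg.i + 1)) := fun x hx => by
    obtain ⟨p, hp⟩ := hFconn x hx _ ht₀F
    exact cfg.child_mem_compU_of_walk p (fun z hz => hFU z (hp z hz)) ht₀c
  -- a free contact is in the component
  have hcontact : ∀ q, bcontact (btour (↑F : Set (Site 2)) e₀ q) ∈ cfg.U →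
      bcontact (btour (↑F : Set (Site 2)) e₀ q) ∈ cfg.compU (cfg.γ.getVert (cfg.i + 1)) := by
    intro q hcU
    have hb := bcontact_spec _ (btour_isBEdge (↑F : Set (Site 2)) he₀ q)
    refine cfg.child_mem_compU_of_walk (SimpleGraph.Walk.cons hb.2.2.symm SimpleGraph.Walk.nil)
      (fun z hz => ?_) (hFc _ (Finset.mem_coe.1 hb.1))
    rw [SimpleGraph.Walk.support_cons, SimpleGraph.Walk.support_nil, List.mem_cons, List.mem_singleton] at hz
    rcases hz with rfl | rfl
    exacts [hcU, hFU _ (Finset.mem_coe.1 hb.1)]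
  -- it suffices to find an arc all of whose contacts are separated from the root by `V_P`
  suffices H : ∃ m n : ℕ, ((m = 0 ∧ n = n₁) ∨ (m = n₁ ∧ n = N)) ∧ ∀ q, m < q → q < n →
      ∀ π : (zdGraph 2).Walk (bcontact (btour (↑F : Set (Site 2)) e₀ q)) (cfg.rootAt (cfg.γ.getVert (cfg.i + 1))),
        (∀ z ∈ π.support, z ∈ cfg.U) → ∃ z ∈ π.support, z ∈ cfg.V cfg.i (cfg.pend cfg.i) by
    obtain ⟨m, n, hmn, hH⟩ := H
    refine ⟨m, n, hmn, fun q i'' hmq hqn hfs hnd hne hc => ?_⟩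
    exact child_rk_lt_of_mem_desc cfg.toPresCfg cfg.i i'' cfg.child_i_mem_farStarts cfg.child_nonDeg_i
      (cfg.child_mem_desc_of_sep hfs hnd hne hc (hcontact q (cfg.child_V_subset_U _ hfs hnd hc)) (hH q hmq hqn))
  by_cases hzV : cfg.rootAt (cfg.γ.getVert (cfg.i + 1)) ∈ cfg.V cfg.i (cfg.pend cfg.i)
  · -- trivial case: the root is an interior vertex of the far-tip piece
    exact ⟨0, n₁, Or.inl ⟨rfl, rfl⟩, fun q _ _ π _ => ⟨_, π.end_mem_support, hzV⟩⟩
  -- the middle and the barrier, with the tour's endpoints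
  obtain ⟨β', hβ'⟩ := cfg.child_exists_middle
  obtain ⟨ω', hω'⟩ := cfg.child_exists_barrier
  set β : (zdGraph 2).Walk (bsite e₀) (bsite (btour (↑F : Set (Site 2)) e₀ n₁)) := β'.copy hbs₀.symm hbs₁.symm
    with hβ
  set ω : (zdGraph 2).Walk (bcontact e₀) (bcontact (btour (↑F : Set (Site 2)) e₀ n₁)) :=
    ω'.copy hbc₀.symm hbc₁.symm with hω
  have hβs : ∀ z ∈ β.support, ∃ m, cfg.τ ≤ m ∧ m ≤ cfg.τ' ∧ cfg.γ.getVert m = z := by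
    intro z hz
    rw [hβ, SimpleGraph.Walk.support_copy] at hz
    exact hβ' z hz
  have hωs : ∀ z ∈ ω.support, (∃ m, cfg.i ≤ m ∧ m < cfg.τ ∧ cfg.γ.getVert m = z) ∨
      (∃ m, cfg.τ' < m ∧ m ≤ cfg.j ∧ cfg.γ.getVert m = z) ∨ z ∈ cfg.Sp ∨ z ∈ cfg.C.support := by
    intro z hz
    rw [hω, SimpleGraph.Walk.support_copy] at hz
    exact hω' z hz
  have hβF : ∀ z ∈ β.support, z ∈ F := fun z hz => by
    obtain ⟨m, h1, h2, rfl⟩ := hβs z hz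
    exact hmid m h1 h2
  have hωF : ∀ z ∈ ω.support, z ∉ F := fun z hz => cfg.child_outer_notMem F hFK hFΛ (hωs z hz)
  -- free sites off `V_P` avoid both
  have havoid : ∀ z ∈ cfg.U, z ∉ cfg.V cfg.i (cfg.pend cfg.i) → z ∉ β.support ∧ z ∉ ω.support := by
    intro z hzU hzV'
    refine ⟨fun hz => ?_, fun hz => cfg.child_not_outer hzU hzV' (hωs z hz)⟩
    obtain ⟨m, h1, h2, rfl⟩ := hβs z hz
    exact hzV' (cfg.child_mem_VP (by omega) (by omega))
  have hdich := btour_rootSide_dichotomy F e₀ n₁ N β ω _ he₀ hn₁ hn₁N hN hinj hβF hωF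
    (havoid _ hz₀U hzV).1 (havoid _ hz₀U hzV).2
  -- a contact that is not root-side is separated from the root by `V_P`
  have hRS : ∀ q, (¬ ∃ π : (zdGraph 2).Walk (bcontact (btour (↑F : Set (Site 2)) e₀ q))
      (cfg.rootAt (cfg.γ.getVert (cfg.i + 1))), ∀ z ∈ π.support, z ∉ β.support ∧ z ∉ ω.support) →
      ∀ π : (zdGraph 2).Walk (bcontact (btour (↑F : Set (Site 2)) e₀ q)) (cfg.rootAt (cfg.γ.getVert (cfg.i + 1))),
        (∀ z ∈ π.support, z ∈ cfg.U) → ∃ z ∈ π.support, z ∈ cfg.V cfg.i (cfg.pend cfg.i) := by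
    intro q hq π hπU
    by_contra hno
    push Not at hno
    exact hq ⟨π, fun z hz => havoid z (hπU z hz) (hno z hz)⟩
  by_cases h1 : ∃ k, 0 < k ∧ k < n₁ ∧ ∃ π : (zdGraph 2).Walk (bcontact (btour (↑F : Set (Site 2)) e₀ k))
      (cfg.rootAt (cfg.γ.getVert (cfg.i + 1))), ∀ z ∈ π.support, z ∉ β.support ∧ z ∉ ω.support
  · exact ⟨n₁, N, Or.inr ⟨rfl, rfl⟩, fun q hmq hqn => hRS q fun hq => hdich h1 ⟨q, hmq, hqn, hq⟩⟩
  · exact ⟨0, n₁, Or.inl ⟨rfl, rfl⟩, fun q hmq hqn => hRS q fun hq => h1 ⟨q, hmq, hqn, hq⟩⟩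

end Summit.CriticalPhenomena.SAWScalingLimit.Theorems.FKGToTraversalBound.SlitNecklace

end
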